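import Mathlib
import Summits.ValiantsHypothesis.ValiantsHypothesis.Theorems.NewtonUnitEquationsDissociatedUniformTotalsLawUnion
import HarnessLib

/-!
# Crux `NewtonUnitEquations.DissociatedUniform` (stmt-ValiantsHypothesis-5905): the `n = 3` totals law — the EXPOSURE PRINCIPLE
# and the co-small union stratum with a constant LINEAR in the number of missing positions

Companion of `…TotalsLawUnion` (`U_s(Z) = ⋃_{z∈Z} P_{s-z} ⊆ A + B`, `unionTotal`, `@[conjecture] UnionTotalsLaw C`, OPEN) and of
`…TotalsLawUnionCoSmall` (g4: POINTWISE `#vert conv U_s(Z) ≤ 2(w+1)²(32(w+1)|G|+1)` for position sets missing `w` positions, via the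
chart-level / shallow-pair machinery).  This file isolates the elementary mechanism behind every "removed fibres" bound:

* **Exposure principle** (pure planar convexity, arbitrary point sets).  For a finite `S ⊆ ℝ²` and a point `u ∈ conv S` that is
  NOT a hull vertex of `S` there are at most three WITNESSES `T ⊆ S ∖ {u}` with `u ∈ conv T` (Krein–Milman for polytopes +
  Carathéodory, `exists_witnesses`); and whenever `u` IS a hull vertex of a subset `S' ⊆ S`, one of its witnesses is missing from `S'`
  (`exists_witness_not_mem`).  So a vertex of `conv S'` is either a vertex of `conv S` or is PAID FOR by a deleted witness.
* **Union totals, co-small stratum, linear constant** (`unionTotal_compl_le`): for EVERY finite abelian `G`, ALL `a b : G → ℝ²` and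
  every finite `W ⊆ G`, `unionTotal a b (G ∖ W) ≤ (2 + 3|W|)·|G|²` — each class has `≤ 2|G|` vertices of `A + B`, and a non-vertex
  `u ∈ A + B` is a vertex of `U_s(G ∖ W)` only in the `≤ 3|W|` classes `s` in which one of its three witnesses is deleted (a word
  `a x + b y` is deleted from `U_s(G ∖ W)` iff `s - x - y ∈ W`).  No general position is needed (a deleted POINT has all its words
  deleted, in particular a chosen one).  Equivalently `unionTotal a b Z ≤ (2 + 3(|G| - |Z|))·|G|²` (`unionTotal_le_linear_cosmall`).
* **`n = 3` law, third curve constant off `w` positions** (`totalVert_le_of_const_off_linear`): `T(a,b,c) ≤ (2 + 4w)·|G|²` for ALL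
  `a b` and arbitrary values at the exceptional positions (g4's `totalVert_le_of_const_off`: `(2(w+1)²(32(w+1)|G|+1) + w|G|)|G|`).
Honest label: the co-small END of the union law only (the law is trivial for `|Z| = O(1)` and now linear-in-`w` for `|G ∖ Z| = w`);
the middle `|Z| ≍ |G|/2` — i.e. `UnionTotalsLaw`, `TwoValuedTotalsLaw`, `TotalsLawThree` — remains OPEN (best general-labelling bound:
`O(|G|^{7/3})`, `…TotalsLawUnionEPRS`).  Nothing here bears on VP ≠ VNP.
[folklore: Carathéodory; Krein–Milman for polytopes; hull vertices of a union are hull vertices of the parts]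
-/

set_option linter.dupNamespace false -- `ValiantsHypothesis.ValiantsHypothesis` (summit = problem) in every name

open scoped BigOperators Pointwise

namespace Summit.ValiantsHypothesis.ValiantsHypothesis.Theorems.NewtonUnitEquationsDissociatedUniform

namespace TotalsLaw

/-! ### The exposure principle (planar, arbitrary finite point sets) -/

/-- For a finite planar set, the hull of the hull vertices is the whole hull (Krein–Milman for polytopes). [folklore] -/
theorem convexHull_extremePoints_eq_of_finite {S : Set (Fin 2 → ℝ)} (hS : S.Finite) :
    convexHull ℝ ((convexHull ℝ S).extremePoints ℝ) = convexHull ℝ S := by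
  have hc : IsCompact (convexHull ℝ S) := Set.Finite.isCompact_convexHull ℝ hS
  have hE : ((convexHull ℝ S).extremePoints ℝ).Finite := hS.subset extremePoints_convexHull_subset
  calc convexHull ℝ ((convexHull ℝ S).extremePoints ℝ)
      = closure (convexHull ℝ ((convexHull ℝ S).extremePoints ℝ)) :=
        ((Set.Finite.isCompact_convexHull ℝ hE).isClosed.closure_eq).symm
    _ = convexHull ℝ S := closure_convexHull_extremePoints hc (convex_convexHull ℝ S)

/-- A point of the hull of a finite planar set which is not a hull vertex lies in the hull of the OTHER points. [folklore] -/
theorem mem_convexHull_diff_of_not_mem_extremePoints {S : Set (Fin 2 → ℝ)} (hS : S.Finite) {u : Fin 2 → ℝ}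
    (hu : u ∈ convexHull ℝ S) (hne : u ∉ (convexHull ℝ S).extremePoints ℝ) :
    u ∈ convexHull ℝ (S \ {u}) := by
  have hsub : (convexHull ℝ S).extremePoints ℝ ⊆ S \ {u} := by
    intro v hv
    refine ⟨extremePoints_convexHull_subset hv, fun h => hne ?_⟩
    rw [Set.mem_singleton_iff] at h
    rwa [h] at hv
  rw [← convexHull_extremePoints_eq_of_finite hS] at hu
  exact convexHull_mono hsub hu

/-- **Planar Carathéodory.**  A point of `conv S` lies in the hull of at most three points of `S`. [folklore] -/
theorem exists_finset_card_le_three_of_mem_convexHull {S : Set (Fin 2 → ℝ)} {u : Fin 2 → ℝ}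
    (hu : u ∈ convexHull ℝ S) :
    ∃ T : Finset (Fin 2 → ℝ), (T : Set (Fin 2 → ℝ)) ⊆ S ∧ T.card ≤ 3 ∧ u ∈ convexHull ℝ (T : Set (Fin 2 → ℝ)) := by
  classical
  rw [convexHull_eq_union] at hu
  simp only [Set.mem_iUnion, exists_prop] at hu
  obtain ⟨T, hTS, hai, huT⟩ := hu
  refine ⟨T, hTS, ?_, huT⟩
  have h := hai.card_le_finrank_succ
  have hle : Module.finrank ℝ (vectorSpan ℝ (Set.range ((↑) : T → (Fin 2 → ℝ)))) ≤ 2 :=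
    (Submodule.finrank_le _).trans (by rw [Module.finrank_fin_fun])
  rw [Fintype.card_coe] at h
  omega

/-- **Witnesses.**  A point `u` of a finite planar set `S` which is not a hull vertex of `S` has a set `T ⊆ S ∖ {u}` of at most
three witnesses with `u ∈ conv T`. [folklore] -/
theorem exists_witnesses {S : Set (Fin 2 → ℝ)} (hS : S.Finite) {u : Fin 2 → ℝ} (huS : u ∈ S)
    (hne : u ∉ (convexHull ℝ S).extremePoints ℝ) :
    ∃ T : Finset (Fin 2 → ℝ), (T : Set (Fin 2 → ℝ)) ⊆ S \ {u} ∧ T.card ≤ 3 ∧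
      u ∈ convexHull ℝ (T : Set (Fin 2 → ℝ)) :=
  exists_finset_card_le_three_of_mem_convexHull
    (mem_convexHull_diff_of_not_mem_extremePoints hS (subset_convexHull ℝ S huS) hne)

/-- **Exposure principle.**  If `u ∈ conv T` with `u ∉ T`, then `u` can be a hull VERTEX of a set `S'` only if some witness `v ∈ T`
is missing from `S'` (otherwise `u ∈ conv (S' ∖ {u})`). [folklore] -/
theorem exists_witness_not_mem {S' : Set (Fin 2 → ℝ)} {u : Fin 2 → ℝ} {T : Finset (Fin 2 → ℝ)}
    (huT : u ∈ convexHull ℝ (T : Set (Fin 2 → ℝ))) (hTu : u ∉ T)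
    (hu : u ∈ (convexHull ℝ S').extremePoints ℝ) : ∃ v ∈ T, v ∉ S' := by
  by_contra h
  push Not at h
  have hTS' : (T : Set (Fin 2 → ℝ)) ⊆ convexHull ℝ S' \ {u} := by
    intro v hv
    refine ⟨subset_convexHull ℝ S' (h v hv), fun hvu => hTu ?_⟩
    rw [Set.mem_singleton_iff] at hvu
    rw [hvu] at hv
    exact hv
  have hconv := ((convex_convexHull ℝ S').mem_extremePoints_iff_convex_sdiff).1 hu
  have hsub : convexHull ℝ (T : Set (Fin 2 → ℝ)) ⊆ convexHull ℝ S' \ {u} := convexHull_min hTS' hconv.2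
  exact (hsub huT).2 (Set.mem_singleton u)

/-! ### The pair sumset as a finset, words and labels -/

variable {G : Type*} [AddCommGroup G] [Fintype G]

/-- Translating the class index: `#{s : s - r ∈ W} = |W|`. [folklore] -/
theorem card_filter_sub_mem (W : Finset G) (r : G) [DecidableEq G] :
    (Finset.univ.filter fun s : G => s - r ∈ W).card = W.card := by
  refine Finset.card_bij (fun s _ => s - r) (fun s hs => (Finset.mem_filter.1 hs).2)
    (fun s₁ _ s₂ _ h => sub_left_injective h) (fun t ht => ⟨t + r, Finset.mem_filter.2 ⟨Finset.mem_univ _, by simpa⟩, by simp⟩)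

omit [Fintype G] in
/-- A word `a x + b (r - x)` of the fibre `P_r` lies in `U_s(Z)` as soon as `s - r ∈ Z`. [folklore] -/
theorem mem_unionPts_of_sub_mem (a b : G → (Fin 2 → ℝ)) {Z : Set G} {s r : G} (x : G) (h : s - r ∈ Z) :
    a x + b (r - x) ∈ unionPts a b Z s := by
  unfold unionPts
  refine Set.mem_iUnion₂.2 ⟨s - r, h, ?_⟩
  rw [sub_sub_cancel]
  exact ⟨x, rfl⟩

/-! ### The co-small stratum of the union totals law with a linear constant -/

/-- **Union totals law, co-small stratum, linear constant (arbitrary labellings).**  For every finite abelian `G`, all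
`a b : G → ℝ²` and every finite set `W` of MISSING positions: `unionTotal a b (G ∖ W) ≤ (2 + 3|W|)·|G|²`.
Proof: a hull vertex of `U_s(G ∖ W) ⊆ A + B` is a hull vertex of `A + B` (`≤ 2|G|` per class, planar Minkowski bound) or a non-vertex
`u` of `A + B` one of whose `≤ 3` witnesses (`exists_witnesses`, chosen once for all classes) is deleted in class `s`
(`exists_witness_not_mem`); the chosen word `a x + b y` of a witness is deleted iff `s - x - y ∈ W`, i.e. in `|W|` classes. [folklore] -/
theorem unionTotal_compl_le (a b : G → (Fin 2 → ℝ)) (W : Finset G) :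
    unionTotal a b ((W : Set G)ᶜ) ≤ (2 + 3 * W.card) * Fintype.card G ^ 2 := by
  classical
  -- the pair sumset `A + B` as a finset, its hull vertices
  set AB : Finset (Fin 2 → ℝ) := Finset.univ.image a + Finset.univ.image b with hAB
  have hABcoe : (AB : Set (Fin 2 → ℝ)) = Set.range a + Set.range b := by
    rw [hAB, Finset.coe_add, Finset.coe_image, Finset.coe_image, Finset.coe_univ, Set.image_univ, Set.image_univ]
  set Ext : Set (Fin 2 → ℝ) := (convexHull ℝ (AB : Set (Fin 2 → ℝ))).extremePoints ℝ with hExt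
  have hExt_le : ∀ s : G, Ext.ncard ≤ 2 * Fintype.card G := by
    intro s
    have h := unionVert_univ_le a b s
    unfold unionVert at h
    rwa [unionPts_univ, ← hABcoe] at h
  have hABcard : AB.card ≤ Fintype.card G ^ 2 := by
    calc AB.card ≤ (Finset.univ.image a).card * (Finset.univ.image b).card := Finset.card_add_le
      _ ≤ Fintype.card G * Fintype.card G := by
          gcongr <;> exact Finset.card_image_le.trans (Finset.card_univ (α := G)).le
      _ = Fintype.card G ^ 2 := (sq _).symm
  -- every class union lies in `A + B`
  have hUsub : ∀ s : G, unionPts a b ((W : Set G)ᶜ) s ⊆ (AB : Set (Fin 2 → ℝ)) := by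
    intro s p hp
    obtain ⟨x, y, -, rfl⟩ := mem_unionPts.1 hp
    rw [hABcoe]
    exact Set.add_mem_add ⟨x, rfl⟩ ⟨y, rfl⟩
  -- witnesses of the non-vertices (chosen once, independently of the class)
  have hT : ∀ u : Fin 2 → ℝ, u ∈ AB → u ∉ Ext → ∃ T : Finset (Fin 2 → ℝ),
      (T : Set (Fin 2 → ℝ)) ⊆ (AB : Set (Fin 2 → ℝ)) \ {u} ∧ T.card ≤ 3 ∧ u ∈ convexHull ℝ (T : Set (Fin 2 → ℝ)) :=
    fun u hu hne => exists_witnesses (Finset.finite_toSet AB) (Finset.mem_coe.2 hu) hne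
  choose! T hT using hT
  -- a word and a fibre label for every point of `A + B`
  have hword : ∀ v : Fin 2 → ℝ, v ∈ AB → ∃ r x : G, a x + b (r - x) = v := by
    intro v hv
    rw [hAB, Finset.mem_add] at hv
    obtain ⟨p, hp, p', hp', rfl⟩ := hv
    obtain ⟨x, -, rfl⟩ := Finset.mem_image.1 hp
    obtain ⟨y, -, rfl⟩ := Finset.mem_image.1 hp'
    exact ⟨x + y, x, by rw [add_sub_cancel_left]⟩
  choose! rr xx hword using hword
  -- per class: vertices of `U_s` are vertices of `A + B` or non-vertices with a deleted witness
  set Bad : G → Finset (Fin 2 → ℝ) := fun s =>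
    AB.filter fun u => u ∉ Ext ∧ ∃ v ∈ T u, s - rr v ∈ W with hBad
  have hclass : ∀ s : G, unionVert a b ((W : Set G)ᶜ) s ≤ 2 * Fintype.card G + (Bad s).card := by
    intro s
    have hExtfin : Ext.Finite := (Finset.finite_toSet AB).subset extremePoints_convexHull_subset
    have hcover : (convexHull ℝ (unionPts a b ((W : Set G)ᶜ) s)).extremePoints ℝ ⊆ Ext ∪ (Bad s : Set (Fin 2 → ℝ)) := by
      intro u hu
      have huU : u ∈ unionPts a b ((W : Set G)ᶜ) s := extremePoints_convexHull_subset hu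
      have huAB : u ∈ AB := Finset.mem_coe.1 (hUsub s huU)
      by_cases hE : u ∈ Ext
      · exact Or.inl hE
      · right
        obtain ⟨hTsub, -, huT⟩ := hT u huAB hE
        have hTu : u ∉ T u := fun h => (hTsub (Finset.mem_coe.2 h)).2 (Set.mem_singleton u)
        obtain ⟨v, hvT, hvU⟩ := exists_witness_not_mem huT hTu hu
        have hvAB : v ∈ AB := Finset.mem_coe.1 (hTsub (Finset.mem_coe.2 hvT)).1
        refine Finset.mem_coe.2 (Finset.mem_filter.2 ⟨huAB, hE, v, hvT, ?_⟩)
        -- the chosen word of `v` is deleted in class `s`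
        by_contra hsW
        apply hvU
        have hmem := mem_unionPts_of_sub_mem a b (Z := ((W : Set G)ᶜ)) (s := s) (r := rr v) (xx v)
          (by simpa using hsW)
        rwa [hword v hvAB] at hmem
    unfold unionVert
    calc ((convexHull ℝ (unionPts a b ((W : Set G)ᶜ) s)).extremePoints ℝ).ncard
        ≤ (Ext ∪ (Bad s : Set (Fin 2 → ℝ))).ncard :=
          Set.ncard_le_ncard hcover (hExtfin.union (Finset.finite_toSet _))
      _ ≤ Ext.ncard + ((Bad s : Finset (Fin 2 → ℝ)) : Set (Fin 2 → ℝ)).ncard := Set.ncard_union_le _ _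
      _ ≤ 2 * Fintype.card G + (Bad s).card := by
          rw [Set.ncard_coe_finset]; exact Nat.add_le_add_right (hExt_le s) _
  -- double counting: each point is bad in at most `3|W|` classes
  have hbad_u : ∀ u ∈ AB, (Finset.univ.filter fun s : G => u ∉ Ext ∧ ∃ v ∈ T u, s - rr v ∈ W).card ≤ 3 * W.card := by
    intro u hu
    by_cases hE : u ∈ Ext
    · have h0 : (Finset.univ.filter fun s : G => u ∉ Ext ∧ ∃ v ∈ T u, s - rr v ∈ W) = ∅ :=
        Finset.filter_eq_empty_iff.2 fun s _ h => h.1 hE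
      rw [h0, Finset.card_empty]
      exact Nat.zero_le _
    · obtain ⟨-, hcard, -⟩ := hT u hu hE
      calc (Finset.univ.filter fun s : G => u ∉ Ext ∧ ∃ v ∈ T u, s - rr v ∈ W).card
          ≤ ((T u).biUnion fun v => Finset.univ.filter fun s : G => s - rr v ∈ W).card := by
            refine Finset.card_le_card fun s hs => ?_
            obtain ⟨-, -, v, hv, hsv⟩ := Finset.mem_filter.1 hs
            exact Finset.mem_biUnion.2 ⟨v, hv, Finset.mem_filter.2 ⟨Finset.mem_univ _, hsv⟩⟩
        _ ≤ ∑ v ∈ T u, (Finset.univ.filter fun s : G => s - rr v ∈ W).card := Finset.card_biUnion_le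
        _ = ∑ _v ∈ T u, W.card := Finset.sum_congr rfl fun v _ => card_filter_sub_mem W (rr v)
        _ = (T u).card * W.card := by rw [Finset.sum_const, smul_eq_mul]
        _ ≤ 3 * W.card := Nat.mul_le_mul_right _ hcard
  have hsum : ∑ s, (Bad s).card ≤ 3 * W.card * Fintype.card G ^ 2 := by
    calc ∑ s, (Bad s).card
        = ∑ s, ∑ u ∈ AB, (if (u ∉ Ext ∧ ∃ v ∈ T u, s - rr v ∈ W) then 1 else 0) :=
          Finset.sum_congr rfl fun s _ => by rw [hBad]; exact Finset.card_filter _ _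
      _ = ∑ u ∈ AB, ∑ s, (if (u ∉ Ext ∧ ∃ v ∈ T u, s - rr v ∈ W) then 1 else 0) := Finset.sum_comm
      _ = ∑ u ∈ AB, (Finset.univ.filter fun s : G => u ∉ Ext ∧ ∃ v ∈ T u, s - rr v ∈ W).card :=
          Finset.sum_congr rfl fun u _ => (Finset.card_filter _ _).symm
      _ ≤ ∑ _u ∈ AB, 3 * W.card := Finset.sum_le_sum hbad_u
      _ = AB.card * (3 * W.card) := by rw [Finset.sum_const, smul_eq_mul]
      _ ≤ Fintype.card G ^ 2 * (3 * W.card) := Nat.mul_le_mul_right _ hABcard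
      _ = 3 * W.card * Fintype.card G ^ 2 := by ring
  -- assemble
  unfold unionTotal
  calc ∑ s, unionVert a b ((W : Set G)ᶜ) s ≤ ∑ s, (2 * Fintype.card G + (Bad s).card) :=
        Finset.sum_le_sum fun s _ => hclass s
    _ = 2 * Fintype.card G * Fintype.card G + ∑ s, (Bad s).card := by
        rw [Finset.sum_add_distrib, Finset.sum_const, Finset.card_univ, smul_eq_mul]; ring
    _ ≤ 2 * Fintype.card G * Fintype.card G + 3 * W.card * Fintype.card G ^ 2 := Nat.add_le_add_left hsum _
    _ = (2 + 3 * W.card) * Fintype.card G ^ 2 := by ring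

/-- The same bound indexed by the position set: `unionTotal a b Z ≤ (2 + 3(|G| - |Z|))·|G|²` for every `Z`. [folklore] -/
theorem unionTotal_le_linear_cosmall (a b : G → (Fin 2 → ℝ)) (Z : Finset G) :
    unionTotal a b (Z : Set G) ≤ (2 + 3 * (Fintype.card G - Z.card)) * Fintype.card G ^ 2 := by
  classical
  have hZ : (Z : Set G) = (((Finset.univ \ Z : Finset G)) : Set G)ᶜ := by
    ext z; simp
  have hcard : (Finset.univ \ Z).card = Fintype.card G - Z.card := by
    rw [Finset.card_sdiff_of_subset (Finset.subset_univ _), Finset.card_univ]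
  rw [hZ, ← hcard]
  exact unionTotal_compl_le a b _

/-! ### The `n = 3` law for third curves constant off `w` positions, linear constant -/

/-- **Third curve constant off `w` positions: `T(a,b,c) ≤ (2 + 4w)·|G|²`** for ALL `a b` (arbitrary values at the exceptional
positions): the totals form of the level-set decomposition (`…TotalsLawUnion.totalVert_le_sum_unionTotal`) splits `T` into the
co-small union total over `{c = v₀}` (`≤ (2 + 3w)|G|²`, `unionTotal_compl_le`) and the unions over the exceptional values (total
position count `≤ w`, each position costing `≤ |G|²`). [folklore] -/
theorem totalVert_le_of_const_off_linear (a b c : G → (Fin 2 → ℝ)) (v₀ : Fin 2 → ℝ) {w : ℕ} [DecidableEq (Fin 2 → ℝ)]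
    (hw : (Finset.univ.filter fun z : G => c z ≠ v₀).card ≤ w) :
    totalVert a b c ≤ (2 + 4 * w) * Fintype.card G ^ 2 := by
  classical
  set Z₁ : Finset G := Finset.univ.filter fun z : G => c z ≠ v₀ with hZ₁
  have hpre : ∀ v, c ⁻¹' {v} = ((Finset.univ.filter fun z : G => c z = v : Finset G) : Set G) := by
    intro v; ext z; simp
  have hpre₀ : c ⁻¹' {v₀} = ((Z₁ : Finset G) : Set G)ᶜ := by
    ext z; simp [hZ₁]
  -- the co-small part
  have h₀ : unionTotal a b (c ⁻¹' {v₀}) ≤ (2 + 3 * w) * Fintype.card G ^ 2 := by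
    rw [hpre₀]
    calc unionTotal a b ((Z₁ : Set G)ᶜ) ≤ (2 + 3 * Z₁.card) * Fintype.card G ^ 2 := unionTotal_compl_le a b Z₁
      _ ≤ (2 + 3 * w) * Fintype.card G ^ 2 := by gcongr
  -- the exceptional parts
  have h₁ : ∑ v ∈ (Finset.univ.image c).erase v₀, unionTotal a b (c ⁻¹' {v}) ≤ w * Fintype.card G ^ 2 := by
    have hfib : Z₁.card = ∑ v ∈ (Finset.univ.image c).erase v₀, (Z₁.filter fun z => c z = v).card :=
      Finset.card_eq_sum_card_fiberwise fun z hz =>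
        Finset.mem_erase.2 ⟨(Finset.mem_filter.1 hz).2, Finset.mem_image.2 ⟨z, Finset.mem_univ _, rfl⟩⟩
    have hfil : ∀ v ∈ (Finset.univ.image c).erase v₀,
        (Z₁.filter fun z => c z = v) = Finset.univ.filter fun z : G => c z = v := by
      intro v hv
      have hv₀ : v ≠ v₀ := (Finset.mem_erase.1 hv).1
      ext z
      simp only [hZ₁, Finset.mem_filter, Finset.mem_univ, true_and]
      constructor
      · exact fun h => h.2
      · intro h
        exact ⟨by rw [h]; exact hv₀, h⟩
    calc ∑ v ∈ (Finset.univ.image c).erase v₀, unionTotal a b (c ⁻¹' {v})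
        ≤ ∑ v ∈ (Finset.univ.image c).erase v₀, (Finset.univ.filter fun z : G => c z = v).card * Fintype.card G ^ 2 :=
          Finset.sum_le_sum fun v _ => by
            rw [hpre v]
            exact unionTotal_le_card_mul a b _
      _ = (∑ v ∈ (Finset.univ.image c).erase v₀, (Z₁.filter fun z => c z = v).card) * Fintype.card G ^ 2 := by
          rw [Finset.sum_mul]
          exact Finset.sum_congr rfl fun v hv => by rw [hfil v hv]
      _ = Z₁.card * Fintype.card G ^ 2 := by rw [← hfib]
      _ ≤ w * Fintype.card G ^ 2 := Nat.mul_le_mul_right _ hw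
  -- assemble
  by_cases hv₀ : v₀ ∈ Finset.univ.image c
  · calc totalVert a b c ≤ ∑ v ∈ Finset.univ.image c, unionTotal a b (c ⁻¹' {v}) := totalVert_le_sum_unionTotal a b c
      _ = unionTotal a b (c ⁻¹' {v₀}) + ∑ v ∈ (Finset.univ.image c).erase v₀, unionTotal a b (c ⁻¹' {v}) :=
          (Finset.add_sum_erase _ _ hv₀).symm
      _ ≤ (2 + 3 * w) * Fintype.card G ^ 2 + w * Fintype.card G ^ 2 := add_le_add h₀ h₁
      _ = (2 + 4 * w) * Fintype.card G ^ 2 := by ring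
  · -- `v₀` is never taken: every position is exceptional, `|G| ≤ w`
    have hall : Z₁ = Finset.univ := by
      refine Finset.eq_univ_of_forall fun z => Finset.mem_filter.2 ⟨Finset.mem_univ _, fun h => hv₀ ?_⟩
      exact Finset.mem_image.2 ⟨z, Finset.mem_univ _, h⟩
    have hq : Fintype.card G ≤ w := by rw [← Finset.card_univ, ← hall]; exact hw
    calc totalVert a b c ≤ Fintype.card G ^ 3 := totalVert_le_card_cube a b c
      _ = Fintype.card G * Fintype.card G ^ 2 := by ring
      _ ≤ w * Fintype.card G ^ 2 := Nat.mul_le_mul_right _ hq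
      _ ≤ (2 + 4 * w) * Fintype.card G ^ 2 := by
          apply Nat.mul_le_mul_right; omega

end TotalsLaw

end Summit.ValiantsHypothesis.ValiantsHypothesis.Theorems.NewtonUnitEquationsDissociatedUniform
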